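import Mathlib
import HarnessLib
import Literature.Analysis.FluidPDE.AxisymmetricEuler
import Literature.Analysis.FluidPDE.AxisymmetricReflection
import Literature.Analysis.FluidPDE.AxisymmetricVorticityTransport
import Literature.Analysis.FluidPDE.KatoSymmetryCovariance
import Literature.Analysis.FluidPDE.KNSSOseenMildDecayTools
import Literature.Analysis.FluidPDE.OseenZoomCovariance
import Summits.NavierStokesRegularity.NavierStokesRegularity.Theorems.UnthreadedDoorCellFluxZDefs
import Summits.NavierStokesRegularity.NavierStokesRegularity.Theorems.TypeILiouvilleTypeIliouvilleLStubOseenConstBoost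
import Summits.NavierStokesRegularity.NavierStokesRegularity.Theorems.PoloidalWindowDoorPoloidalWindowRigidityOneSlice

/-!
# Route `UnthreadedDoor` / `ThreadingFlux`, crux `PoloidalLiouville` (stmt-NavierStokesRegularity-1222), antidynamo v2 skeleton (sha16 `4ebf5683127b`),
# WALL `stub_scalarLiouville`: ONE-INSTANT FRAME LEMMA — a swirl-free axisymmetric slice of a bounded Oseen-ancient field, up to a constant,
# is swirl-free axisymmetric at EVERY time in the Galilean frame boosted by that constant

Support file (seat leafhand-ns-unthreadeddoor-2 g2, cell decomp-ns), `--supports stmt-NavierStokesRegularity-1222 --as helper`; theorems only.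

This is the dynamic half of the g1 repair-census item (1) «ONE-INSTANT Z» for the wall.  The «missing» Literature lemma named there (Galilean BOOST
covariance of the Oseen-mild formulation) is in fact in the tree: `Theorems.stub_oseen_const_boost` (crux `TypeIliouvilleL`, KNSS drift-mild Galilean
covariance `IsKNSSDriftMild.galileanCovariance_R3`).  With it:

* §1 the bounded OSEEN-ANCIENT class (continuous on `(−∞,0) × ℝ³`, uniformly bounded, Oseen integral identity `W(t) = e^{(t−s)Δ}W(s) − B¹_s(W,W)(t)`
  pointwise for all `s < t < 0`) is closed under translations, conjugation by linear isometries, the frame change `conjAxis R p`, and — for fields with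
  weakly divergence-free slices — the constant Galilean boost re-centred at a time `t₁`: `W♭(t, y) = W(t, y + (t − t₁)k) − k`
  (`oseenAncient_translate/conj/conjAxis/boost`);
* §2 ★★ `axisymNoSwirl_of_slice` — **a bounded Oseen-ancient field axisymmetric WITHOUT swirl at ONE time `t₁ < 0` is so at EVERY `t < 0`**: forward by
  bounded Oseen-mild uniqueness and backward by real-analyticity in time (both packaged in the tree's `conj_eq_of_slice`), applied to the rotations
  `rotZLIE θ` (`isAxisymmetric_iff_conj_rotZLIE`) and to the meridian reflection `reflY` (`IsAxisymmetric.conj_reflY_eq` / `hasNoSwirl_of_conj_reflY_eq`);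
* §3 ★★ `isAxisymmetricNoSwirlAbout_boost_of_slice` — frame form: if `W(t₁) − k` is axisymmetric without swirl about the axis through `p` straightened
  by `R`, then the boosted field `W♭(t) = W(t, · + (t − t₁)k) − k` is axisymmetric without swirl about the same axis at every `t < 0`.

HONEST LABEL: Galilean/Euclidean bookkeeping over landed theorems (KNSS 2009 §4 uniqueness, Lemarié-Rieusset 2016 Thm 9.12 analyticity, Majda–Bertozzi
§1.2 Galilean invariance); nothing here proves `stub_scalarLiouville`, `PoloidalLiouville` (1222), or bears on Navier–Stokes regularity; no summit
statement is proved. [folklore] [cite: KochNadirashviliSereginSverak2009, §4 (4.3)–(4.4) (arXiv:0709.3599 p. 8); MajdaBertozziCUP2002, §1.2 and §2.3.3]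
-/

noncomputable section

-- the summit and its single sub-problem share the name (CONVENTIONS §1)
set_option linter.dupNamespace false

open Set Function Filter Topology MeasureTheory Metric
open scoped RealInnerProductSpace
open Literature.Analysis Literature.Analysis.FluidPDE

namespace Summit.NavierStokesRegularity.NavierStokesRegularity.Theorems.PoloidalLiouville.Antidynamo

open Summit.NavierStokesRegularity.NavierStokesRegularity.Theorems.PoloidalLiouville.NetFlux (E3)
open Summit.NavierStokesRegularity.NavierStokesRegularity.Theorems.PoloidalLiouville.CellFlux
  (conjAxis IsAxisymmetricNoSwirlAbout conjAxis_apply)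
open Summit.NavierStokesRegularity.NavierStokesRegularity.Theorems.PoloidalWindowDoorPoloidalWindowRigidityOneSlice
  (conj_eq_of_slice)

namespace OneInstant

variable {W : ℝ → E3 → E3}

/-! ### §1 Closure properties of the bounded Oseen-ancient class -/

/-- **Translation covariance**: `(t, y) ↦ W(t, y + a)` is again bounded Oseen-ancient (`heatExtension_comp_add_right`, `oseenDuhamel_comp_add_right`).
[folklore] -/
theorem oseenAncient_translate
    (hc : ContinuousOn (uncurry W) (Iio (0 : ℝ) ×ˢ univ)) (hb : ∃ K : ℝ, ∀ t < 0, ∀ y, ‖W t y‖ ≤ K)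
    (hm : ∀ s t : ℝ, s < t → t < 0 → ∀ y,
      W t y = UnboundedOperators.heatExtension (W s) (t - s) y - oseenDuhamel 1 s W W t y)
    (a : E3) :
    ContinuousOn (uncurry fun t y => W t (y + a)) (Iio (0 : ℝ) ×ˢ univ) ∧
    (∃ K : ℝ, ∀ t < 0, ∀ y, ‖(fun t y => W t (y + a)) t y‖ ≤ K) ∧
    (∀ s t : ℝ, s < t → t < 0 → ∀ y, (fun t y => W t (y + a)) t y =
      UnboundedOperators.heatExtension ((fun t y => W t (y + a)) s) (t - s) y -
        oseenDuhamel 1 s (fun t y => W t (y + a)) (fun t y => W t (y + a)) t y) := by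
  refine ⟨?_, ?_, fun s t hst ht y => ?_⟩
  · have h1 : Continuous (fun p : ℝ × E3 => (p.1, p.2 + a)) :=
      continuous_fst.prodMk (continuous_snd.add continuous_const)
    have h2 : MapsTo (fun p : ℝ × E3 => (p.1, p.2 + a)) (Iio (0 : ℝ) ×ˢ univ) (Iio (0 : ℝ) ×ˢ univ) :=
      fun p hp => mem_prod.2 ⟨(mem_prod.1 hp).1, mem_univ _⟩
    exact hc.comp h1.continuousOn h2
  · obtain ⟨K, hK⟩ := hb
    exact ⟨K, fun t ht y => hK t ht (y + a)⟩
  · show W t (y + a) = UnboundedOperators.heatExtension (fun y => W s (y + a)) (t - s) y -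
      oseenDuhamel 1 s (fun τ y => W τ (y + a)) (fun τ y => W τ (y + a)) t y
    rw [heatExtension_comp_add_right, oseenDuhamel_comp_add_right]
    exact hm s t hst ht (y + a)

/-- **Isometry covariance**: `(t, y) ↦ L (W(t, L⁻¹ y))` is again bounded Oseen-ancient (`heatExtension_conj_linearIsometryEquiv`,
`oseenDuhamel_symm_conj_linearIsometryEquiv`). [folklore] -/
theorem oseenAncient_conj
    (hc : ContinuousOn (uncurry W) (Iio (0 : ℝ) ×ˢ univ)) (hb : ∃ K : ℝ, ∀ t < 0, ∀ y, ‖W t y‖ ≤ K)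
    (hm : ∀ s t : ℝ, s < t → t < 0 → ∀ y,
      W t y = UnboundedOperators.heatExtension (W s) (t - s) y - oseenDuhamel 1 s W W t y)
    (L : E3 ≃ₗᵢ[ℝ] E3) :
    ContinuousOn (uncurry fun t y => L (W t (L.symm y))) (Iio (0 : ℝ) ×ˢ univ) ∧
    (∃ K : ℝ, ∀ t < 0, ∀ y, ‖(fun t y => L (W t (L.symm y))) t y‖ ≤ K) ∧
    (∀ s t : ℝ, s < t → t < 0 → ∀ y, (fun t y => L (W t (L.symm y))) t y =
      UnboundedOperators.heatExtension ((fun t y => L (W t (L.symm y))) s) (t - s) y -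
        oseenDuhamel 1 s (fun t y => L (W t (L.symm y))) (fun t y => L (W t (L.symm y))) t y) := by
  refine ⟨?_, ?_, fun s t hst ht y => ?_⟩
  · have h1 : Continuous (fun p : ℝ × E3 => (p.1, L.symm p.2)) :=
      continuous_fst.prodMk (L.symm.continuous.comp continuous_snd)
    have h2 : MapsTo (fun p : ℝ × E3 => (p.1, L.symm p.2)) (Iio (0 : ℝ) ×ˢ univ) (Iio (0 : ℝ) ×ˢ univ) :=
      fun p hp => mem_prod.2 ⟨(mem_prod.1 hp).1, mem_univ _⟩
    exact L.continuous.comp_continuousOn (hc.comp h1.continuousOn h2)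
  · obtain ⟨K, hK⟩ := hb
    refine ⟨K, fun t ht y => ?_⟩
    show ‖L (W t (L.symm y))‖ ≤ K
    rw [L.norm_map]
    exact hK t ht _
  · show L (W t (L.symm y)) = UnboundedOperators.heatExtension (fun y => L (W s (L.symm y))) (t - s) y -
      oseenDuhamel 1 s (fun τ y => L (W τ (L.symm y))) (fun τ y => L (W τ (L.symm y))) t y
    rw [heatExtension_conj_linearIsometryEquiv L (W s) (t - s) y]
    have h2 := oseenDuhamel_symm_conj_linearIsometryEquiv L.symm 1 s W W t y
    simp only [LinearIsometryEquiv.symm_symm] at h2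
    rw [h2, hm s t hst ht (L.symm y), map_sub]

/-- **Frame covariance**: the straightened field `(t, y) ↦ conjAxis R p (W t) y = R (W (t, R⁻¹ y + p))` is again bounded Oseen-ancient. [folklore] -/
theorem oseenAncient_conjAxis
    (hc : ContinuousOn (uncurry W) (Iio (0 : ℝ) ×ˢ univ)) (hb : ∃ K : ℝ, ∀ t < 0, ∀ y, ‖W t y‖ ≤ K)
    (hm : ∀ s t : ℝ, s < t → t < 0 → ∀ y,
      W t y = UnboundedOperators.heatExtension (W s) (t - s) y - oseenDuhamel 1 s W W t y)
    (R : E3 ≃ₗᵢ[ℝ] E3) (p : E3) :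
    ContinuousOn (uncurry fun t y => conjAxis R p (W t) y) (Iio (0 : ℝ) ×ˢ univ) ∧
    (∃ K : ℝ, ∀ t < 0, ∀ y, ‖(fun t y => conjAxis R p (W t) y) t y‖ ≤ K) ∧
    (∀ s t : ℝ, s < t → t < 0 → ∀ y, (fun t y => conjAxis R p (W t) y) t y =
      UnboundedOperators.heatExtension ((fun t y => conjAxis R p (W t) y) s) (t - s) y -
        oseenDuhamel 1 s (fun t y => conjAxis R p (W t) y) (fun t y => conjAxis R p (W t) y) t y) := by
  obtain ⟨hc₁, hb₁, hm₁⟩ := oseenAncient_translate hc hb hm p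
  exact oseenAncient_conj hc₁ hb₁ hm₁ R

/-- **Constant Galilean boost, re-centred at `t₁`**: for a bounded Oseen-ancient field with weakly divergence-free slices and a constant vector `k`,
`W♭(t, y) = W(t, y + (t − t₁) k) − k` is again bounded Oseen-ancient (the tree's `stub_oseen_const_boost`, i.e. KNSS drift-mild Galilean covariance,
followed by the translation by `−t₁ k`). [cite: KochNadirashviliSereginSverak2009, §1 p. 3 and §4 (4.3)–(4.4) (arXiv:0709.3599 pp. 3, 8)] -/
theorem oseenAncient_boost
    (hc : ContinuousOn (uncurry W) (Iio (0 : ℝ) ×ˢ univ)) (hb : ∃ K : ℝ, ∀ t < 0, ∀ y, ‖W t y‖ ≤ K)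
    (hdiv : ∀ t < 0, IsWeaklyDivFree (W t))
    (hm : ∀ s t : ℝ, s < t → t < 0 → ∀ y,
      W t y = UnboundedOperators.heatExtension (W s) (t - s) y - oseenDuhamel 1 s W W t y)
    (k : E3) (t₁ : ℝ) :
    ContinuousOn (uncurry fun t y => W t (y + (t - t₁) • k) - k) (Iio (0 : ℝ) ×ˢ univ) ∧
    (∃ K : ℝ, ∀ t < 0, ∀ y, ‖(fun t y => W t (y + (t - t₁) • k) - k) t y‖ ≤ K) ∧
    (∀ s t : ℝ, s < t → t < 0 → ∀ y, (fun t y => W t (y + (t - t₁) • k) - k) t y =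
      UnboundedOperators.heatExtension ((fun t y => W t (y + (t - t₁) • k) - k) s) (t - s) y -
        oseenDuhamel 1 s (fun t y => W t (y + (t - t₁) • k) - k) (fun t y => W t (y + (t - t₁) • k) - k) t y) := by
  obtain ⟨hc', hb', -, hm'⟩ := Theorems.stub_oseen_const_boost W k hc hb hdiv hm
  have e : (fun t y => W t (y + (t - t₁) • k) - k) = fun t y => (fun t y => W t (y + t • k) - k) t (y + -(t₁ • k)) := by
    funext t y
    simp only [sub_smul]
    congr 2
    abel
  rw [e]
  exact oseenAncient_translate hc' hb' hm' (-(t₁ • k))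

/-! ### §2 ★★ One swirl-free axisymmetric slice ⇒ all slices -/

/-- ★★ **ONE-SLICE PROPAGATION OF AXISYMMETRY WITHOUT SWIRL in the bounded Oseen-ancient class.**  If `U` is continuous on `(−∞,0) × ℝ³`,
uniformly bounded, satisfies the Oseen integral identity between any two negative times, and ONE slice `U(t₁)`, `t₁ < 0`, is axisymmetric
without swirl (about the `x₂`-axis), then EVERY slice `U(t)`, `t < 0`, is: the rotations `R_θ` and the meridian reflection `σ` are linear
isometries fixing `U(t₁)` under conjugation, and a conjugation symmetry of one slice is a symmetry of every slice (tree `conj_eq_of_slice`: forward by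
bounded Oseen-mild uniqueness, backward by time analyticity). [cite: KochNadirashviliSereginSverak2009, §4 (4.3)–(4.4) (arXiv:0709.3599 p. 8); MajdaBertozziCUP2002, §2.3.3 (2.52)–(2.53)] -/
theorem axisymNoSwirl_of_slice {U : ℝ → E3 → E3}
    (hc : ContinuousOn (uncurry U) (Iio (0 : ℝ) ×ˢ univ)) (hb : ∃ K : ℝ, ∀ t < 0, ∀ y, ‖U t y‖ ≤ K)
    (hm : ∀ s t : ℝ, s < t → t < 0 → ∀ y,
      U t y = UnboundedOperators.heatExtension (U s) (t - s) y - oseenDuhamel 1 s U U t y)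
    {t₁ : ℝ} (ht₁ : t₁ < 0) (hax : IsAxisymmetric (U t₁)) (hsw : HasNoSwirl (U t₁)) :
    ∀ t < 0, IsAxisymmetric (U t) ∧ HasNoSwirl (U t) := by
  have hbdd : ∀ δ : ℝ, 0 < δ → ∃ B : ℝ, ∀ t < -δ, ∀ y : E3, ‖U t y‖ ≤ B := fun δ hδ => by
    obtain ⟨K, hK⟩ := hb
    exact ⟨K, fun t ht y => hK t (by linarith) y⟩
  intro t ht
  have hax' : IsAxisymmetric (U t) := by
    rw [isAxisymmetric_iff_conj_rotZLIE]
    intro θ x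
    exact conj_eq_of_slice hc hbdd hm (rotZLIE θ) ht₁ ((isAxisymmetric_iff_conj_rotZLIE _).1 hax θ) t ht x
  exact ⟨hax', hax'.hasNoSwirl_of_conj_reflY_eq fun x => conj_eq_of_slice hc hbdd hm reflY ht₁ (hax.conj_reflY_eq hsw) t ht x⟩

/-! ### §3 ★★ Frame form with the boost -/

/-- At the re-centring time the boost is trivial: `W♭(t₁) = W(t₁) − k`. [folklore] -/
theorem boost_slice_self (W : ℝ → E3 → E3) (k : E3) (t₁ : ℝ) :
    (fun t y => W t (y + (t - t₁) • k) - k) t₁ = fun y => W t₁ y - k := by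
  funext y
  simp

/-- ★★ **ONE SWIRL-FREE AXISYMMETRIC SLICE UP TO A CONSTANT ⇒ SWIRL-FREE AXISYMMETRIC AT EVERY TIME IN THE BOOSTED FRAME.**  Let `W` be bounded
Oseen-ancient with weakly divergence-free slices.  If at ONE time `t₁ < 0` the slice `W(t₁) − k` is axisymmetric without swirl about the axis through `p`
straightened by the frame `R`, then the boosted field `W♭(t) = W(t, · + (t − t₁)k) − k` is axisymmetric without swirl about that axis at EVERY `t < 0`
(`W♭` is bounded Oseen-ancient by §1, its straightened version `conjAxis R p (W♭ t)` too, and `W♭(t₁) = W(t₁) − k`; then §2).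
[cite: KochNadirashviliSereginSverak2009, §1 p. 3 and §4 (arXiv:0709.3599 pp. 3, 8); MajdaBertozziCUP2002, §1.2, §2.3.3] -/
theorem isAxisymmetricNoSwirlAbout_boost_of_slice
    (hc : ContinuousOn (uncurry W) (Iio (0 : ℝ) ×ˢ univ)) (hb : ∃ K : ℝ, ∀ t < 0, ∀ y, ‖W t y‖ ≤ K)
    (hdiv : ∀ t < 0, IsWeaklyDivFree (W t))
    (hm : ∀ s t : ℝ, s < t → t < 0 → ∀ y,
      W t y = UnboundedOperators.heatExtension (W s) (t - s) y - oseenDuhamel 1 s W W t y)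
    {R : E3 ≃ₗᵢ[ℝ] E3} {p k : E3} {t₁ : ℝ} (ht₁ : t₁ < 0)
    (h₁ : IsAxisymmetricNoSwirlAbout R p (fun y => W t₁ y - k)) :
    ∀ t < 0, IsAxisymmetricNoSwirlAbout R p ((fun t y => W t (y + (t - t₁) • k) - k) t) := by
  obtain ⟨hc', hb', hm'⟩ := oseenAncient_boost hc hb hdiv hm k t₁
  obtain ⟨hcU, hbU, hmU⟩ := oseenAncient_conjAxis hc' hb' hm' R p
  have h0 : (fun t y => conjAxis R p ((fun t y => W t (y + (t - t₁) • k) - k) t) y) t₁ =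
      conjAxis R p (fun y => W t₁ y - k) := by
    funext y
    simp [conjAxis]
  have hax₁ : IsAxisymmetric ((fun t y => conjAxis R p ((fun t y => W t (y + (t - t₁) • k) - k) t) y) t₁) := by
    rw [h0]
    exact h₁.1
  have hsw₁ : HasNoSwirl ((fun t y => conjAxis R p ((fun t y => W t (y + (t - t₁) • k) - k) t) y) t₁) := by
    rw [h0]
    exact h₁.2
  intro t ht
  exact axisymNoSwirl_of_slice hcU hbU hmU ht₁ hax₁ hsw₁ t ht

end OneInstant

end Summit.NavierStokesRegularity.NavierStokesRegularity.Theorems.PoloidalLiouville.Antidynamo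

end
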